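import Summits.CriticalPhenomena.PercolationContinuityZ3.Theorems.PercNearOneGluingNoHeavyLowerTailKnQuestion8CoefficientwiseCoreClassKernelMixTwoStageCharging
import Summits.CriticalPhenomena.PercolationContinuityZ3.Theorems.PercNearOneGluingNoHeavyLowerTailKnQuestion8CoefficientwiseCoreClassKernelMixTwoStageProduct

/-!
# H-spaces and cycle factors: the abstract cycle step of the two-type theorem (THEOREM A)

Support file (`--supports stmt-CriticalPhenomena-4575`, closed), prover `prim-cplus-coupling` (gen 66).  No notations, no named facts, no sorries;
standard axioms.  Memo `prim-cplus-coupling/A5-COUPLING-gen66.md` §1–2.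

An **H-space** packages, on a finite preordered type `X` with a 'mirror' `c`, a witness region `NF`, a class of LEVELS and a matching `Φ W : X → X`
for every level `W` (increasing on `W`, injective on `W`, landing in the mirror `{x | c x ∈ W}`), the two-type invariant
  H:  for all levels `D, B`, every upper set `U` and every set `S` of collision pairs `(x₁,x₂) ∈ D × B` (`Φ D x₁ = Φ B x₂`) whose common upper
      cone lies in `U`:  `#S ≤ #(U ∩ NF)`.
A **cycle factor** packages what the single new cycle must provide (memo §1.1, §2 CLAIM): levels with matchings `φ V` as above whose targets lie in a
row set `NE`, and a LAYER map `λ : NE → NF`, injective, with EVERY SOURCE BELOW THE LAYER OF ITS TARGET: `y ≤ λ (φ V y)` (this single axiom encodes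
bi-discipline at the full word, the chain shift of the full level and the exactness of the chain rows).
THEOREM `isHSpace_prod`: the product of an H-space and a cycle factor, with levels = 'all fibres are levels of the factor and all rows are levels of
the space' and the TWO-STAGE matchings `Φ(x,y) = (Φ_{row} x, φ_{fibre} y)`, is again an H-space (via `TwoStageProduct` and `TwoStageCharging.two_stage_charging`).
Iterating over the cycles of a bouquet (base: the one-point H-space `isHSpace_unit`) gives H, hence JP-match and JP/(X2), on every bouquet of cycles.
[cite: KozmaNitzan2024, Questions 8–9 (§5.5 p. 36) (context); Harris 1960; Kleitman 1966]
-/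

namespace Summit.CriticalPhenomena.PercolationContinuityZ3.Theorems.Coefficientwise.HSpace

open Finset ReducedKleitman TwoStageProduct TwoStageCharging

variable {X Y : Type*}

section Defs

variable [Fintype X] [DecidableEq X] [Preorder X]

/-- The H-space property of the data `(NF, c, Level, Φ)` on `X` (memo gen 66 §2, invariant H together with the matching axioms). -/
structure IsHSpace (NF : Finset X) (c : X → X) (Level : Finset X → Prop) (Φ : Finset X → X → X) : Prop where
  /-- levels live in the witness region -/
  level_sub : ∀ W, Level W → W ⊆ NF
  /-- the matching of a level is increasing on it -/
  incr : ∀ W, Level W → ∀ x ∈ W, x ≤ Φ W x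
  /-- the matching lands in the mirror of the level -/
  mirror : ∀ W, Level W → ∀ x ∈ W, c (Φ W x) ∈ W
  /-- the matching is injective on the level -/
  inj : ∀ W, Level W → ∀ x ∈ W, ∀ x' ∈ W, Φ W x = Φ W x' → x = x'
  /-- invariant H: collision pairs whose common upper cone lies in an upper set `U` are at most `#(U ∩ NF)` -/
  hall : ∀ D B, Level D → Level B → ∀ U : Finset X, IsUpperSet (U : Set X) →
    ∀ S : Finset (X × X), S ⊆ D ×ˢ B → (∀ p ∈ S, Φ D p.1 = Φ B p.2 ∧ ∀ q : X, p.1 ≤ q → p.2 ≤ q → q ∈ U) →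
    S.card ≤ (U ∩ NF).card

end Defs

section CycleFactor

variable [Fintype Y] [DecidableEq Y] [Preorder Y]

/-- A cycle factor on `Y`: levels with increasing injective matchings into their mirrors, targets in the row set `NE`, and an injective layer
map `lam : NE → NF` with every source below the layer of its target (memo gen 66 §1.1 and §2 CLAIM (i)–(iii) packaged as one axiom). -/
structure IsCycleFactor (NF NE : Finset Y) (c : Y → Y) (Level : Finset Y → Prop) (φ : Finset Y → Y → Y) (lam : Y → Y) : Prop where
  /-- levels live in the witness region -/
  level_sub : ∀ V, Level V → V ⊆ NF
  /-- increasing -/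
  incr : ∀ V, Level V → ∀ y ∈ V, y ≤ φ V y
  /-- lands in the mirror -/
  mirror : ∀ V, Level V → ∀ y ∈ V, c (φ V y) ∈ V
  /-- injective on the level -/
  inj : ∀ V, Level V → ∀ y ∈ V, ∀ y' ∈ V, φ V y = φ V y' → y = y'
  /-- targets are rows -/
  target_mem : ∀ V, Level V → ∀ y ∈ V, φ V y ∈ NE
  /-- the layer map is injective on rows -/
  lam_inj : Set.InjOn lam (NE : Set Y)
  /-- layers are witness coordinates -/
  lam_mem : ∀ y ∈ NE, lam y ∈ NF
  /-- every source lies below the layer of its target -/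
  src_le_lam : ∀ V, Level V → ∀ y ∈ V, y ≤ lam (φ V y)

end CycleFactor

section Product

variable [Fintype X] [DecidableEq X] [Preorder X] [Fintype Y] [DecidableEq Y] [Preorder Y]

/-- Levels of the product: every fibre is a level of the factor and every row is a level of the space. -/
def ProdLevel (LX : Finset X → Prop) (LY : Finset Y → Prop) (W : Finset (X × Y)) : Prop :=
  (∀ x, LY (fibL W x)) ∧ (∀ v, LX (fibR W v))

/-- The two-stage matching of a product level `W`: inner = the factor's matching of the fibre, outer = the space's matching of the row
`W_{cY y*}` of the target coordinate `y*`. -/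
def prodPhi (cY : Y → Y) (ΦX : Finset X → X → X) (φY : Finset Y → Y → Y) (W : Finset (X × Y)) (z : X × Y) : X × Y :=
  (ΦX (fibR W (cY (φY (fibL W z.1) z.2))) z.1, φY (fibL W z.1) z.2)

omit [Preorder X] [Preorder Y] in
/-- Components of the product matching. -/
theorem prodPhi_apply (cY : Y → Y) (ΦX : Finset X → X → X) (φY : Finset Y → Y → Y) (W : Finset (X × Y)) (z : X × Y) :
    prodPhi cY ΦX φY W z = (ΦX (fibR W (cY (φY (fibL W z.1) z.2))) z.1, φY (fibL W z.1) z.2) := rfl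

open Classical in
/-- **THEOREM A (abstract cycle step).**  The product of an H-space `X` and a cycle factor `Y`, with product levels and two-stage matchings,
is an H-space with witness region `NF_X ×ˢ NF_Y` and mirror `c = (cX, cY)`.  Memo gen 66 §2. -/
theorem isHSpace_prod {NFX : Finset X} {cX : X → X} {LX : Finset X → Prop} {ΦX : Finset X → X → X}
    {NFY NEY : Finset Y} {cY : Y → Y} {LY : Finset Y → Prop} {φY : Finset Y → Y → Y} {lam : Y → Y}
    (hX : IsHSpace NFX cX LX ΦX) (hY : IsCycleFactor NFY NEY cY LY φY lam) :
    IsHSpace (NFX ×ˢ NFY) (fun z => (cX z.1, cY z.2)) (ProdLevel LX LY) (prodPhi cY ΦX φY) := by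
  -- unpack the inner/outer hypotheses in the form used by `TwoStageProduct`
  have hin : ∀ W, ProdLevel LX LY W → ∀ x y, (x, y) ∈ W →
      y ≤ φY (fibL W x) y ∧ (x, cY (φY (fibL W x) y)) ∈ W := by
    intro W hW x y hxy
    have hf : y ∈ fibL W x := mem_fibL.mpr hxy
    exact ⟨hY.incr _ (hW.1 x) y hf, mem_fibL.mp (hY.mirror _ (hW.1 x) y hf)⟩
  have hout : ∀ W, ProdLevel LX LY W → ∀ v x, (x, cY v) ∈ W →
      x ≤ ΦX (fibR W (cY v)) x ∧ (cX (ΦX (fibR W (cY v)) x), cY v) ∈ W := by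
    intro W hW v x hx
    have hr : x ∈ fibR W (cY v) := mem_fibR.mpr hx
    exact ⟨hX.incr _ (hW.2 (cY v)) x hr, mem_fibR.mp (hX.mirror _ (hW.2 (cY v)) x hr)⟩
  have hin_inj : ∀ W, ProdLevel LX LY W → ∀ x y y', (x, y) ∈ W → (x, y') ∈ W →
      φY (fibL W x) y = φY (fibL W x) y' → y = y' := by
    intro W hW x y y' h h' e
    exact hY.inj _ (hW.1 x) y (mem_fibL.mpr h) y' (mem_fibL.mpr h') e
  have hout_inj : ∀ W, ProdLevel LX LY W → ∀ v x x', (x, cY v) ∈ W → (x', cY v) ∈ W →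
      ΦX (fibR W (cY v)) x = ΦX (fibR W (cY v)) x' → x = x' := by
    intro W hW v x x' h h' e
    exact hX.inj _ (hW.2 (cY v)) x (mem_fibR.mpr h) x' (mem_fibR.mpr h') e
  refine ⟨?_, ?_, ?_, ?_, ?_⟩
  · -- level_sub
    intro W hW z hz
    obtain ⟨x, y⟩ := z
    exact mem_product.mpr ⟨hX.level_sub _ (hW.2 y) (mem_fibR.mpr hz), hY.level_sub _ (hW.1 x) (mem_fibL.mpr hz)⟩
  · -- incr
    intro W hW z hz
    rw [prodPhi_apply]
    exact two_stage_increasing W cX cY (fun x => φY (fibL W x)) (fun v => ΦX (fibR W (cY v))) (hin W hW) (hout W hW) z hz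
  · -- mirror
    intro W hW z hz
    rw [prodPhi_apply]
    exact two_stage_mirror W cX cY (fun x => φY (fibL W x)) (fun v => ΦX (fibR W (cY v)))
      (fun x y h => (hin W hW x y h).2) (fun v x h => (hout W hW v x h).2) z hz
  · -- inj
    intro W hW z hz z' hz' e
    rw [prodPhi_apply, prodPhi_apply] at e
    exact two_stage_injOn W cY (fun x => φY (fibL W x)) (fun v => ΦX (fibR W (cY v)))
      (fun x y h => (hin W hW x y h).2) (hin_inj W hW) (hout_inj W hW) z z' hz hz' e
  · -- hall: rows + layers
    intro D B hD hB U hU S hS hSP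
    -- the collision set and its rows
    set Coll : Finset ((X × Y) × (X × Y)) :=
      (D ×ˢ B).filter (fun c => prodPhi cY ΦX φY D c.1 = prodPhi cY ΦX φY B c.2) with hColl
    set row : (X × Y) × (X × Y) → Y := fun c => (prodPhi cY ΦX φY D c.1).2 with hrowdef
    have hrow_eq : ∀ c, row c = φY (fibL D c.1.1) c.1.2 := fun c => rfl
    have hrow : ∀ c ∈ Coll, row c ∈ NEY := by
      intro c hc
      obtain ⟨hcDB, _⟩ := mem_filter.mp hc
      obtain ⟨hcD, _⟩ := mem_product.mp hcDB
      rw [hrow_eq]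
      exact hY.target_mem _ (hD.1 c.1.1) c.1.2 (mem_fibL.mpr (by simpa using hcD))
    have hyj : ∀ c ∈ Coll, c.1.2 ≤ lam (row c) ∧ c.2.2 ≤ lam (row c) := by
      intro c hc
      obtain ⟨hcDB, hce⟩ := mem_filter.mp hc
      obtain ⟨hcD, hcB⟩ := mem_product.mp hcDB
      rw [prodPhi_apply, prodPhi_apply, Prod.mk.injEq] at hce
      refine ⟨?_, ?_⟩
      · rw [hrow_eq]
        exact hY.src_le_lam _ (hD.1 c.1.1) c.1.2 (mem_fibL.mpr (by simpa using hcD))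
      · rw [hrow_eq, hce.2]
        exact hY.src_le_lam _ (hB.1 c.2.1) c.2.2 (mem_fibL.mpr (by simpa using hcB))
    -- per-row bound from H(X) on the row pair
    have hXrow : ∀ v ∈ NEY, ∀ U' : Finset X, IsUpperSet (U' : Set X) →
        ((Coll.filter (fun c => row c = v)).filter
          (fun c => ∀ p : X, c.1.1 ≤ p → c.2.1 ≤ p → p ∈ U')).card ≤ (U' ∩ NFX).card := by
      intro v _ U' hU'
      -- rewrite the row filter in the form of `row_bound_of_outer`
      have hset : (Coll.filter (fun c => row c = v)) =
          (D ×ˢ B).filter (fun c =>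
            (ΦX (fibR D (cY (φY (fibL D c.1.1) c.1.2))) c.1.1, φY (fibL D c.1.1) c.1.2) =
              (ΦX (fibR B (cY (φY (fibL B c.2.1) c.2.2))) c.2.1, φY (fibL B c.2.1) c.2.2) ∧
            φY (fibL D c.1.1) c.1.2 = v) := by
        rw [hColl, filter_filter]
        rfl
      rw [hset]
      refine row_bound_of_outer D B cY (fun x => φY (fibL D x)) (fun x => φY (fibL B x))
        (fun w => ΦX (fibR D (cY w))) (fun w => ΦX (fibR B (cY w)))
        (fun x y h => (hin D hD x y h).2) (fun x y h => (hin B hB x y h).2) (hin_inj D hD) (hin_inj B hB) NFX v U' ?_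
      -- H(X) for the row pair, subset form → filter form
      refine hX.hall (fibR D (cY v)) (fibR B (cY v)) (hD.2 (cY v)) (hB.2 (cY v)) U' hU' _ ?_ ?_
      · intro p hp
        exact (mem_filter.mp (mem_filter.mp hp).1).1
      · intro p hp
        obtain ⟨hp1, hp2⟩ := mem_filter.mp hp
        exact ⟨(mem_filter.mp hp1).2, hp2⟩
    -- apply the charging theorem to the upper set U of Z
    have key := two_stage_charging NFX NFY NEY Coll row lam hrow hY.lam_inj hY.lam_mem hyj hXrow U hU
    -- S is contained in the good collisions
    refine le_trans (card_le_card ?_) key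
    intro c hc
    obtain ⟨hce, hcone⟩ := hSP c hc
    exact mem_filter.mpr ⟨mem_filter.mpr ⟨hS hc, hce⟩, hcone⟩

end Product

section Unit

/-- **The one-point H-space** (the empty bouquet): `NF = {()}`, every finset a level, `Φ = id`. -/
theorem isHSpace_unit : IsHSpace (X := Unit) {()} id (fun _ => True) (fun _ x => x) := by
  refine ⟨?_, ?_, ?_, ?_, ?_⟩
  · intro W _ x _; simp
  · intro W _ x _; exact le_rfl
  · intro W _ x hx; simpa using hx
  · intro W _ x _ x' _ _; rfl
  · intro D B _ _ U hU S hS hSP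
    classical
    by_cases hSe : S = ∅
    · simp [hSe]
    · obtain ⟨p, hp⟩ := nonempty_iff_ne_empty.mpr hSe
      have hu : () ∈ U := (hSP p hp).2 () (le_rfl) (le_rfl)
      have hU1 : (U ∩ {()}).card = 1 := by
        rw [show U ∩ {()} = {()} from ?_]
        · rfl
        · ext u; simp [hu]
      have hS1 : S.card ≤ 1 := by
        calc S.card ≤ (univ : Finset (Unit × Unit)).card := card_le_card (subset_univ S)
          _ = 1 := by simp
      omega

end Unit

end Summit.CriticalPhenomena.PercolationContinuityZ3.Theorems.Coefficientwise.HSpace
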